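import Summits.BirchSwinnertonDyer.BirchSwinnertonDyer.Theorems.PrintCf2RamifiedOffTYZSelmerRankOneOfDisplays
import Literature.NumberTheory.EllipticCurves.TianYuanZhang2017.CMPointFrobeniusDisplays
import HarnessLib

/-!
# Crux `PrintCf2.RamifiedOffTYZOfFacts` (stmt-BirchSwinnertonDyer-20509), line `offtyz-v7`, LEAD cycle 8 (cruxlead-20509 g7):
# THE MINIMAL-SELMER CASE OF THE CONGRUENT NUMBER PROBLEM AT `p = 2` FOR `n ≡ 5 (mod 8)`, FROM THE NAMED FACTS —
# `tyz_cmPointRingClassFrobeniusData ∧ thm11_parity_of_scriptL ⟹ ∀ square-free n ≡ 5 (8), #Sel₂(E_n) = 8 → ord = rank = 1 ∧ Ш[2^∞] = 0 ∧ BSD(E_n, 2)`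

THEOREMS ONLY (no `def`, no `sorry`), `--supports stmt-BirchSwinnertonDyer-20509` — the `s = 1` stratum of the residual item 23432 `RamifiedOffJumpOneOfFacts`
for `n ≡ 5 (mod 8)`, packaged on the two named printed facts it uses (by-name wrappers of `…SelmerRankOneOfDisplays`):
* `TianYuanZhang2017.tyz_cmPointRingClassFrobeniusData` — TYZ 2017 §3 AS PRINTED (genus-point displays, CM-point layer, conductor-`2`/`4` ring class
  dictionary of Prop. 3.2, and the Frobenius elements of the ramified primes; `CMPointFrobeniusDisplays.lean`, p691528); it refines
  `tyz_cmPointRingClassData` (`tyz_cmPointRingClassData_of_frobeniusData`);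
* `TianYuanZhang2017.thm11_parity_of_scriptL` — TYZ Thm 1.1 (parity of `𝓛(m)`, `m ≡ 1 (mod 8)`, for the cofactors `n/d`).
BSD is not proved by any of this; no route item is closed by this file (helper toward 23432/20509; the planner may file the `OfFacts` statement, which
`selmerEight_mod_eight_five_bsdp_two_of_facts` closes by name).

References: [cite: TianYuanZhang2017, Thm. 1.1, Thm. 1.2, §3 (Prop. 3.2, Prop. 3.4, Thm. 3.5, Thm. 3.6, Lemma 3.18, Lemma 3.21)];
[cite: Smith2016CongruentDensity, Thm. 1.2, Thm. 1.4]; [cite: HeathBrown1994SelmerCongruentII, Appendix (Monsky)]; [cite: Cox2013, §5.C, §9.A];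
[cite: MilneADT2006, Thm. I.7.3]; [cite: Miller2011LMS, Def. 1.1].
-/

noncomputable section

open scoped Classical

open WeierstrassCurve Literature.NumberTheory.EllipticCurves Literature.NumberTheory.EllipticCurves.TianYuanZhang2017

set_option autoImplicit false

namespace Summit.BirchSwinnertonDyer.PrintCf2.MoverAssembly

/-! ## §1 The refined fact implies the older ones -/

/-- Dropping the Frobenius clause: `CMPointRingClassFrobeniusPrinted ⟹ CMPointRingClassPrinted`. [cite: TianYuanZhang2017, §3.1 and Prop. 3.2 (1)(2)] -/
theorem cmPointRingClassPrinted_of_frobeniusPrinted {n : ℕ} (D : GenusPointData n) (h : D.CMPointRingClassFrobeniusPrinted) :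
    D.CMPointRingClassPrinted := by
  obtain ⟨z, Φ, ΓH, ΓH', σ, θ, c, ρ₂, ρ₄, hc, hall⟩ := h
  exact ⟨z, Φ, ΓH, ΓH', σ, θ, c, ρ₂, ρ₄, hc, fun d hd =>
    ⟨(hall d hd).1, (hall d hd).2.1, (hall d hd).2.2.1, (hall d hd).2.2.2.1, (hall d hd).2.2.2.2.1⟩⟩

/-- `tyz_cmPointRingClassFrobeniusData ⟹ tyz_cmPointRingClassData` (hence also `tyz_cmPointGaloisData`, `tyz_genusPointData`).
[cite: TianYuanZhang2017, §3] -/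
theorem tyz_cmPointRingClassData_of_frobeniusData (h : tyz_cmPointRingClassFrobeniusData) : tyz_cmPointRingClassData := by
  intro n hn h8
  obtain ⟨D, hD, hF⟩ := h n hn h8
  exact ⟨D, hD, cmPointRingClassPrinted_of_frobeniusPrinted D hF⟩

/-! ## §2 The `s = 1` stratum for `n ≡ 5 (mod 8)` from the named facts -/

/-- **THE MINIMAL-SELMER CASE AT `p = 2` FOR `n ≡ 5 (mod 8)`, from the named facts.**  Granted Tian–Yuan–Zhang 2017 §3 as printed with the Frobenius
elements of the ramified primes (`tyz_cmPointRingClassFrobeniusData`) and TYZ Thm 1.1 (`thm11_parity_of_scriptL`): for every square-free `n ≡ 5 (mod 8)`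
with `#Sel⁽²⁾(E_n/ℚ) = 8`, `ord_{s=1} L(E_n, s) = 1`, `rank E_n(ℚ) = 1`, `Ш(E_n/ℚ)[2^∞] = 0` and `BSD(E_n, 2)`.
[cite: TianYuanZhang2017, Thm. 1.1 and §3 (Prop. 3.2 (1), Thm. 3.5, Thm. 3.6 (1), Lemma 3.18, proof of Lemma 3.21)]
[cite: HeathBrown1994SelmerCongruentII, Appendix (Monsky), typescript p. 39 L10–L41] [cite: Smith2016CongruentDensity, Thm. 1.4] [cite: Miller2011LMS, Def. 1.1] -/
theorem rankOne_sha_bsdp_two_of_selmerEight_of_facts (hF : tyz_cmPointRingClassFrobeniusData) (h11 : thm11_parity_of_scriptL)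
    {n : ℕ} (hsq : Squarefree n) (h5 : n % 8 = 5)
    (hsel : haveI := isElliptic_congruentNumberCurve hsq.ne_zero; Nat.card ((congruentNumberCurve n).selmerGroup 2) = 8) :
    haveI := isElliptic_congruentNumberCurve hsq.ne_zero
    (congruentNumberCurve n).analyticRank = 1 ∧ (congruentNumberCurve n).mordellWeilRank = 1 ∧
      AddCommGroup.primaryComponent (congruentNumberCurve n).sha 2 = ⊥ ∧ BSDp (congruentNumberCurve n) 2 := by
  obtain ⟨D, hPr, hCM⟩ := hF n hsq (Or.inl h5)
  exact rankOne_sha_bsdp_two_of_selmerEight_of_displays hsq h5 D hPr hCM h11 hsel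

/-- **`OfFacts` shape for the planner**: the conjunction of the two printed facts implies, for every square-free `n ≡ 5 (mod 8)` with
`#Sel₂(E_n) = 8`, `ord = rank = 1`, `Ш[2^∞] = 0` and BSD(E_n, 2). [cite: TianYuanZhang2017, Thm. 1.1 and §3] [cite: Miller2011LMS, Def. 1.1] -/
theorem selmerEight_mod_eight_five_bsdp_two_of_facts :
    (tyz_cmPointRingClassFrobeniusData ∧ thm11_parity_of_scriptL) →
      ∀ n : ℕ, (hsq : Squarefree n) → n % 8 = 5 →
        (haveI := isElliptic_congruentNumberCurve hsq.ne_zero; Nat.card ((congruentNumberCurve n).selmerGroup 2) = 8) →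
        haveI := isElliptic_congruentNumberCurve hsq.ne_zero
        (congruentNumberCurve n).analyticRank = 1 ∧ (congruentNumberCurve n).mordellWeilRank = 1 ∧
          AddCommGroup.primaryComponent (congruentNumberCurve n).sha 2 = ⊥ ∧ BSDp (congruentNumberCurve n) 2 :=
  fun h _ hsq h5 hsel => rankOne_sha_bsdp_two_of_selmerEight_of_facts h.1 h.2 hsq h5 hsel

/-! ## §3 Isogeny saturation from the named facts (conjuncts 1–3 of 𝔅_ram) -/

/-- **`BSD(W, 2)` for every globally minimal `W/ℚ` isogenous to a minimal-Selmer `E_n`, `n ≡ 5 (mod 8)`**, granted the two printed TYZ facts and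
conjuncts 1–3 of the route's bundle 𝔅_ram (GZK, entire `L`, Cassels). [cite: MilneADT2006, Thm. I.7.3] [cite: TianYuanZhang2017, Thm. 1.1 and §3] [cite: Miller2011LMS, Def. 1.1] -/
theorem bsdp_two_of_isIsogenous_selmerEight_mod_eight_five (hF : tyz_cmPointRingClassFrobeniusData) (h11 : thm11_parity_of_scriptL)
    (hGZK : rank_eq_analyticRank_of_analyticRank_le_one) (hL : hasEntireLFunction_rat) (hCassels : bsdRHS_eq_of_isIsogenous)
    {W : WeierstrassCurve ℚ} [W.IsElliptic] [W.IsGloballyMinimal]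
    {n : ℕ} (hsq : Squarefree n) (h5 : n % 8 = 5)
    (hsel : haveI := isElliptic_congruentNumberCurve hsq.ne_zero; Nat.card ((congruentNumberCurve n).selmerGroup 2) = 8)
    (hiso : IsIsogenous W (congruentNumberCurve n)) : BSDp W 2 := by
  obtain ⟨D, hPr, hCM⟩ := hF n hsq (Or.inl h5)
  exact bsdp_two_of_isIsogenous_selmerEight_of_displays hGZK hL hCassels hsq h5 D hPr hCM h11 hsel hiso

end Summit.BirchSwinnertonDyer.PrintCf2.MoverAssembly

end
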